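import Mathlib
import Literature.MathematicalPhysics.KineticTheory.HardSphereEuler
import Summits.AtomisticToContinuum.HydrodynamicLimit.Theorems.CorrectorPressureDecay.Negative.OrthEnergyTools
import HarnessLib

/-!
# `StaticScoreResponse` (support item stmt-AtomisticToContinuum-12269): moments of the standard
# Gaussian up to order four

The velocity parts of the score of a local Gibbs state are polynomials of degree two in the
velocity, and the hydrodynamic fields are polynomials of degree at most two; the covariances of the
two therefore involve Gaussian moments up to order four. This file computes them for the standard
Gaussian `γ = stdGaussian (EuclideanSpace ℝ ι)` (`ι = Fin 3` for `𝕋³ × ℝ³`):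

* one dimension (`gaussianReal 0 1`): `E x³ = 0` (`moment_three_gaussianReal`; derivatives of the
  moment generating function `exp(t²/2)`); `E x² = 1` and `E x⁴ = 3` are REUSED from the tree
  (`CorrectorPressureDecayNegative.OrthEnergy.integral_sq_gaussianReal`,
  `BoltzmannGreenKuboOrthMomentum.integral_pow_four_gaussianReal`);
* coordinates of `γ` are independent standard normals (`map_pi_eq_stdGaussian`): mixed moments
  `E[w_l^j w_m^k]` (`integral_coord_pow_mul_coord_pow`);
* the aggregate identities used downstream: `E ⟪w, c⟫ = 0`, `E ⟪w, c⟫⟪w, e⟫ = ⟪c, e⟫`,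
  `E ‖w‖² ⟪w, c⟫ = 0` (`integral_inner_stdGaussian`, `integral_inner_mul_inner_stdGaussian`,
  `integral_norm_sq_mul_inner_stdGaussian`) and, in dimension three, `E ‖w‖⁴ = 15`
  (`integral_norm_pow_four_stdGaussian_three`).

Folklore; no definitions, no named facts.
-/

noncomputable section

namespace Summit.AtomisticToContinuum.HydrodynamicLimit.Theorems

open MeasureTheory ProbabilityTheory Set Filter Topology Finset
open scoped ENNReal NNReal InnerProductSpace

/-! ### One dimension: moments of `gaussianReal 0 1` from the moment generating function -/

/-- The moment generating function of the standard normal is `exp(t²/2)`. [folklore] -/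
theorem mgf_id_gaussianReal_zero_one : mgf id (gaussianReal 0 1) = fun t => Real.exp (t ^ 2 / 2) := by
  rw [mgf_id_gaussianReal]
  funext t
  simp

/-- The moments of the standard normal are the derivatives of `exp(t²/2)` at `0`. [folklore] -/
theorem moment_gaussianReal_eq_iteratedDeriv (n : ℕ) :
    ∫ x, x ^ n ∂gaussianReal 0 1 = iteratedDeriv n (fun t => Real.exp (t ^ 2 / 2)) 0 := by
  have h := iteratedDeriv_mgf_zero (X := id) (μ := gaussianReal 0 1)
    (by rw [integrableExpSet_id_gaussianReal]; simp) n
  rw [mgf_id_gaussianReal_zero_one] at h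
  rw [h]
  rfl

/-- `(exp(t²/2))' = t exp(t²/2)` (as `HasDerivAt`). [folklore] -/
theorem hasDerivAt_exp_sq_half (t : ℝ) :
    HasDerivAt (fun t : ℝ => Real.exp (t ^ 2 / 2)) (t * Real.exp (t ^ 2 / 2)) t := by
  have h : HasDerivAt (fun t : ℝ => t ^ 2 / 2) t t :=
    ((hasDerivAt_pow 2 t).div_const 2).congr_deriv (by norm_num)
  exact h.exp.congr_deriv (by ring)

/-- `(exp(t²/2))' = t exp(t²/2)`. [folklore] -/
theorem deriv_exp_sq_half : deriv (fun t : ℝ => Real.exp (t ^ 2 / 2)) = fun t => t * Real.exp (t ^ 2 / 2) :=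
  funext fun t => (hasDerivAt_exp_sq_half t).deriv

/-- `(t exp(t²/2))' = (t² + 1) exp(t²/2)`. [folklore] -/
theorem deriv_mul_exp_sq_half :
    deriv (fun t : ℝ => t * Real.exp (t ^ 2 / 2)) = fun t => (t ^ 2 + 1) * Real.exp (t ^ 2 / 2) := by
  funext t
  have h : HasDerivAt (fun t : ℝ => t * Real.exp (t ^ 2 / 2))
      (1 * Real.exp (t ^ 2 / 2) + t * (t * Real.exp (t ^ 2 / 2))) t := (hasDerivAt_id' t).mul (hasDerivAt_exp_sq_half t)
  rw [h.deriv]; ring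

/-- `((t² + 1) exp(t²/2))' = (t³ + 3t) exp(t²/2)`. [folklore] -/
theorem deriv_sq_add_one_mul_exp_sq_half :
    deriv (fun t : ℝ => (t ^ 2 + 1) * Real.exp (t ^ 2 / 2)) = fun t => (t ^ 3 + 3 * t) * Real.exp (t ^ 2 / 2) := by
  funext t
  have hp : HasDerivAt (fun t : ℝ => t ^ 2 + 1) (2 * t) t :=
    ((hasDerivAt_pow 2 t).add_const 1).congr_deriv (by norm_num)
  have h : HasDerivAt (fun t : ℝ => (t ^ 2 + 1) * Real.exp (t ^ 2 / 2))
      (2 * t * Real.exp (t ^ 2 / 2) + (t ^ 2 + 1) * (t * Real.exp (t ^ 2 / 2))) t := hp.mul (hasDerivAt_exp_sq_half t)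
  rw [h.deriv]; ring

/-- **Third moment of the standard normal**: `E x³ = 0`. [folklore] -/
theorem moment_three_gaussianReal : ∫ x, x ^ 3 ∂gaussianReal 0 1 = 0 := by
  rw [moment_gaussianReal_eq_iteratedDeriv, iteratedDeriv_succ, iteratedDeriv_succ, iteratedDeriv_one,
    deriv_exp_sq_half, deriv_mul_exp_sq_half, deriv_sq_add_one_mul_exp_sq_half]
  simp

/-- First moment: `E x = 0`. [folklore] -/
theorem moment_one_gaussianReal : ∫ x, x ^ 1 ∂gaussianReal 0 1 = 0 := by
  simp [integral_id_gaussianReal]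

/-- Powers are integrable under the standard normal. [folklore] -/
theorem integrable_pow_gaussianReal (n : ℕ) : Integrable (fun x : ℝ => x ^ n) (gaussianReal 0 1) := by
  rcases Nat.eq_zero_or_pos n with hn | hn
  · subst hn; simp
  have h := (memLp_id_gaussianReal' (μ := 0) (v := 1) n (by simp)).integrable_norm_pow (by exact_mod_cast hn.ne')
  refine h.mono' (by fun_prop : Measurable fun x : ℝ => x ^ n).aestronglyMeasurable (ae_of_all _ fun x => ?_)
  simp

/-! ### Product coordinates: independent standard normals -/

section Pi

variable {ι : Type*} [Fintype ι]

/-- Moments of a single coordinate under the product of standard normals. [folklore] -/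
theorem integral_coord_pow_pi (l : ι) (n : ℕ) :
    ∫ x, (x l) ^ n ∂Measure.pi (fun _ : ι => gaussianReal 0 1) = ∫ y, y ^ n ∂gaussianReal 0 1 := by
  have h := integral_map (μ := Measure.pi fun _ : ι => gaussianReal 0 1) (φ := Function.eval l)
    (measurable_pi_apply l).aemeasurable (f := fun y : ℝ => y ^ n)
    ((by fun_prop : Measurable fun y : ℝ => y ^ n).aestronglyMeasurable)
  rw [(measurePreserving_eval (fun _ : ι => gaussianReal 0 1) l).map_eq] at h
  exact h.symm

/-- Powers of a single coordinate are integrable under the product of standard normals. [folklore] -/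
theorem integrable_coord_pow_pi (l : ι) (n : ℕ) :
    Integrable (fun x : ι → ℝ => (x l) ^ n) (Measure.pi fun _ : ι => gaussianReal 0 1) := by
  have h := (measurePreserving_eval (fun _ : ι => gaussianReal 0 1) l).integrable_comp
    ((by fun_prop : Measurable fun y : ℝ => y ^ n).aestronglyMeasurable)
  exact h.2 (integrable_pow_gaussianReal n)

/-- **Mixed moments of distinct coordinates factorise**:
`E[x_l^j x_m^k] = E[x^j] E[x^k]` for `l ≠ m` (independence of the coordinates). [folklore] -/
theorem integral_coord_pow_mul_coord_pow_pi {l m : ι} (hlm : l ≠ m) (j k : ℕ) :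
    ∫ x, (x l) ^ j * (x m) ^ k ∂Measure.pi (fun _ : ι => gaussianReal 0 1) =
      (∫ y, y ^ j ∂gaussianReal 0 1) * ∫ y, y ^ k ∂gaussianReal 0 1 := by
  have hind : iIndepFun (fun i (ω : ι → ℝ) => ω i) (Measure.pi fun _ : ι => gaussianReal 0 1) :=
    iIndepFun_pi (X := fun _ => id) fun _ => aemeasurable_id
  have h2 : IndepFun (fun ω : ι → ℝ => (ω l) ^ j) (fun ω : ι → ℝ => (ω m) ^ k) (Measure.pi fun _ : ι => gaussianReal 0 1) :=
    (hind.indepFun hlm).comp (by fun_prop : Measurable fun y : ℝ => y ^ j) (by fun_prop : Measurable fun y : ℝ => y ^ k)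
  have h3 := h2.integral_mul_eq_mul_integral
    ((measurable_pi_apply l).pow_const j).aestronglyMeasurable ((measurable_pi_apply m).pow_const k).aestronglyMeasurable
  simp only [Pi.mul_apply] at h3
  rw [h3, integral_coord_pow_pi, integral_coord_pow_pi]

/-- Monomials in two coordinates are integrable under the product of standard normals. [folklore] -/
theorem integrable_coord_pow_mul_coord_pow_pi (l m : ι) (j k : ℕ) :
    Integrable (fun x : ι → ℝ => (x l) ^ j * (x m) ^ k) (Measure.pi fun _ : ι => gaussianReal 0 1) := by
  by_cases hlm : l = m
  · subst hlm
    have : (fun x : ι → ℝ => (x l) ^ j * (x l) ^ k) = fun x => (x l) ^ (j + k) := funext fun x => by ring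
    rw [this]
    exact integrable_coord_pow_pi l (j + k)
  · have hind : iIndepFun (fun i (ω : ι → ℝ) => ω i) (Measure.pi fun _ : ι => gaussianReal 0 1) :=
      iIndepFun_pi (X := fun _ => id) fun _ => aemeasurable_id
    have h2 : IndepFun (fun ω : ι → ℝ => (ω l) ^ j) (fun ω : ι → ℝ => (ω m) ^ k) (Measure.pi fun _ : ι => gaussianReal 0 1) :=
      (hind.indepFun hlm).comp (by fun_prop : Measurable fun y : ℝ => y ^ j) (by fun_prop : Measurable fun y : ℝ => y ^ k)
    exact h2.integrable_mul (integrable_coord_pow_pi l j) (integrable_coord_pow_pi m k)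

/-- `E[x_l² x_m] = 0` for all `l, m`. [folklore] -/
theorem integral_coord_sq_mul_coord_pi (l m : ι) :
    ∫ x, (x l) ^ 2 * (x m) ^ 1 ∂Measure.pi (fun _ : ι => gaussianReal 0 1) = 0 := by
  by_cases hlm : l = m
  · subst hlm
    have : ∀ x : ι → ℝ, (x l) ^ 2 * (x l) ^ 1 = (x l) ^ 3 := fun x => by ring
    simp_rw [this]
    rw [integral_coord_pow_pi]
    exact moment_three_gaussianReal
  · rw [integral_coord_pow_mul_coord_pow_pi hlm, moment_one_gaussianReal, mul_zero]

/-- `E[x_l x_m] = δ_{lm}`. [folklore] -/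
theorem integral_coord_mul_coord_pi [DecidableEq ι] (l m : ι) :
    ∫ x, (x l) ^ 1 * (x m) ^ 1 ∂Measure.pi (fun _ : ι => gaussianReal 0 1) = if l = m then 1 else 0 := by
  by_cases hlm : l = m
  · subst hlm
    rw [if_pos rfl]
    have : ∀ x : ι → ℝ, (x l) ^ 1 * (x l) ^ 1 = (x l) ^ 2 := fun x => by ring
    simp_rw [this]
    rw [integral_coord_pow_pi]
    exact CorrectorPressureDecayNegative.OrthEnergy.integral_sq_gaussianReal
  · rw [integral_coord_pow_mul_coord_pow_pi hlm, moment_one_gaussianReal, mul_zero, if_neg hlm]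

/-- `E[x_l² x_m²] = 3` if `l = m`, `1` otherwise. [folklore] -/
theorem integral_coord_sq_mul_coord_sq_pi [DecidableEq ι] (l m : ι) :
    ∫ x, (x l) ^ 2 * (x m) ^ 2 ∂Measure.pi (fun _ : ι => gaussianReal 0 1) = if l = m then 3 else 1 := by
  by_cases hlm : l = m
  · subst hlm
    rw [if_pos rfl]
    have : ∀ x : ι → ℝ, (x l) ^ 2 * (x l) ^ 2 = (x l) ^ 4 := fun x => by ring
    simp_rw [this]
    rw [integral_coord_pow_pi]
    exact BoltzmannGreenKuboOrthMomentum.integral_pow_four_gaussianReal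
  · rw [integral_coord_pow_mul_coord_pow_pi hlm, CorrectorPressureDecayNegative.OrthEnergy.integral_sq_gaussianReal, mul_one, if_neg hlm]

end Pi

/-! ### The standard Gaussian on Euclidean space -/

section Euclidean

variable {ι : Type*} [Fintype ι]

/-- Transfer of integrals to the independent coordinates. [folklore] -/
theorem integral_stdGaussian_eq_pi {F : EuclideanSpace ℝ ι → ℝ} (hF : Measurable F) :
    ∫ w, F w ∂stdGaussian (EuclideanSpace ℝ ι) = ∫ x, F (WithLp.toLp 2 x) ∂Measure.pi (fun _ : ι => gaussianReal 0 1) := by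
  rw [← map_pi_eq_stdGaussian, integral_map (PiLp.continuous_toLp 2 _).aemeasurable hF.aestronglyMeasurable]

/-- The real inner product on `ℝ^ι` in coordinates. [folklore] -/
theorem real_inner_eq_sum (w c : EuclideanSpace ℝ ι) : ⟪w, c⟫_ℝ = ∑ l, w l * c l := by
  rw [PiLp.inner_apply]
  refine Finset.sum_congr rfl fun l _ => ?_
  simp [RCLike.inner_apply, mul_comm]

/-- The squared norm on `ℝ^ι` in coordinates. [folklore] -/
theorem norm_sq_eq_sum_sq (w : EuclideanSpace ℝ ι) : ‖w‖ ^ 2 = ∑ l, (w l) ^ 2 := by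
  rw [EuclideanSpace.real_norm_sq_eq]

/-- **`E ⟪w, c⟫ = 0`**. [folklore] -/
theorem integral_inner_stdGaussian (c : EuclideanSpace ℝ ι) :
    ∫ w, ⟪w, c⟫_ℝ ∂stdGaussian (EuclideanSpace ℝ ι) = 0 := by
  have h := integral_strongDual_stdGaussian (E := EuclideanSpace ℝ ι) (innerSL ℝ c)
  have h' : ∫ w, ⟪c, w⟫_ℝ ∂stdGaussian (EuclideanSpace ℝ ι) = 0 := by simpa using h
  calc ∫ w, ⟪w, c⟫_ℝ ∂stdGaussian (EuclideanSpace ℝ ι) = ∫ w, ⟪c, w⟫_ℝ ∂stdGaussian (EuclideanSpace ℝ ι) :=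
        integral_congr_ae (ae_of_all _ fun w => real_inner_comm c w)
    _ = 0 := h'

/-- **`E ⟪w, c⟫⟪w, e⟫ = ⟪c, e⟫`** (the covariance of the standard Gaussian is the identity).
[folklore] -/
theorem integral_inner_mul_inner_stdGaussian [DecidableEq ι] (c e : EuclideanSpace ℝ ι) :
    ∫ w, ⟪w, c⟫_ℝ * ⟪w, e⟫_ℝ ∂stdGaussian (EuclideanSpace ℝ ι) = ⟪c, e⟫_ℝ := by
  have hmeas : Measurable fun w : EuclideanSpace ℝ ι => ⟪w, c⟫_ℝ * ⟪w, e⟫_ℝ := by fun_prop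
  rw [integral_stdGaussian_eq_pi hmeas]
  simp only [real_inner_eq_sum]
  -- expand the product of sums
  have hexp : ∀ x : ι → ℝ, (∑ l, x l * c l) * ∑ m, x m * e m = ∑ l, ∑ m, c l * e m * ((x l) ^ 1 * (x m) ^ 1) := by
    intro x
    rw [Finset.sum_mul_sum]
    refine Finset.sum_congr rfl fun l _ => Finset.sum_congr rfl fun m _ => by ring
  simp_rw [hexp]
  rw [integral_finsetSum _ fun l _ => integrable_finsetSum _ fun m _ => (integrable_coord_pow_mul_coord_pow_pi l m 1 1).const_mul _]
  rw [Finset.sum_congr rfl fun l _ => integral_finsetSum _ fun m _ => (integrable_coord_pow_mul_coord_pow_pi l m 1 1).const_mul _]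
  simp_rw [integral_const_mul, integral_coord_mul_coord_pi]
  simp [Finset.sum_ite_eq, mul_comm]

/-- **`E ‖w‖² ⟪w, c⟫ = 0`** (odd moments vanish). [folklore] -/
theorem integral_norm_sq_mul_inner_stdGaussian (c : EuclideanSpace ℝ ι) :
    ∫ w, ‖w‖ ^ 2 * ⟪w, c⟫_ℝ ∂stdGaussian (EuclideanSpace ℝ ι) = 0 := by
  classical
  have hmeas : Measurable fun w : EuclideanSpace ℝ ι => ‖w‖ ^ 2 * ⟪w, c⟫_ℝ := by fun_prop
  rw [integral_stdGaussian_eq_pi hmeas]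
  simp only [real_inner_eq_sum, norm_sq_eq_sum_sq]
  have hexp : ∀ x : ι → ℝ, (∑ l, (x l) ^ 2) * ∑ m, x m * c m = ∑ l, ∑ m, c m * ((x l) ^ 2 * (x m) ^ 1) := by
    intro x
    rw [Finset.sum_mul_sum]
    refine Finset.sum_congr rfl fun l _ => Finset.sum_congr rfl fun m _ => by ring
  simp_rw [hexp]
  rw [integral_finsetSum _ fun l _ => integrable_finsetSum _ fun m _ => (integrable_coord_pow_mul_coord_pow_pi l m 2 1).const_mul _]
  rw [Finset.sum_congr rfl fun l _ => integral_finsetSum _ fun m _ => (integrable_coord_pow_mul_coord_pow_pi l m 2 1).const_mul _]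
  simp_rw [integral_const_mul, integral_coord_sq_mul_coord_pi]
  simp

/-- **`E ‖w‖⁴ = 15`** for the standard Gaussian on `ℝ³` (`= d² + 2d`, `d = 3`). [folklore] -/
theorem integral_norm_pow_four_stdGaussian_three :
    ∫ w, ‖w‖ ^ 4 ∂stdGaussian (EuclideanSpace ℝ (Fin 3)) = 15 := by
  have hmeas : Measurable fun w : EuclideanSpace ℝ (Fin 3) => ‖w‖ ^ 4 := by fun_prop
  rw [integral_stdGaussian_eq_pi hmeas]
  have h4 : ∀ x : Fin 3 → ℝ, ‖(WithLp.toLp 2 x : EuclideanSpace ℝ (Fin 3))‖ ^ 4 =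
      ∑ l, ∑ m, (x l) ^ 2 * (x m) ^ 2 := by
    intro x
    rw [show (4 : ℕ) = 2 * 2 by norm_num, pow_mul, norm_sq_eq_sum_sq]
    rw [sq, Finset.sum_mul_sum]
  simp_rw [h4]
  rw [integral_finsetSum _ fun l _ => integrable_finsetSum _ fun m _ => integrable_coord_pow_mul_coord_pow_pi l m 2 2]
  rw [Finset.sum_congr rfl fun l _ => integral_finsetSum _ fun m _ => integrable_coord_pow_mul_coord_pow_pi l m 2 2]
  simp_rw [integral_coord_sq_mul_coord_sq_pi]
  simp [Fin.sum_univ_three]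
  norm_num

end Euclidean

end Summit.AtomisticToContinuum.HydrodynamicLimit.Theorems

end
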